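import Summits.Ventures.AbcSig.Rows.Bridge
import Summits.Ventures.AbcSig.Rows.C2aL229A45X
import Summits.Ventures.AbcSig.Rows.C2aL229A45XAB

/-!
# Venture AbcSig — CELL `C2aL229A45`: the census statement `Rows.C2aCellRed 229 (fun a => a = 4 ∨ a = 5) ∅` from the two row theorems

HONEST FRAMING. COMPUTATION cell `pub-abcsig`; CONDITIONAL theorem; no claim on ABC or any summit. Hypotheses exactly as
in `Rows/C2aL229A45X.lean` and `Rows/C2aL229A45XAB.lean`: `BS04Package` (CITED), `DataComplete …` (COMPUTED level files), `EisPackage` (CITED) and `Refines` (COMPUTED) for the M6 orbits discharged in the kernel, and the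
rows' per-orbit exclusions for BOTH family predicates (`famB`, `famAB`) as universally quantified hypotheses (CITED: the census
row's certificates). Conclusion = p1's census predicate (`Rows/Statements.lean`), all four coprime coefficient
distributions `A·B = 2^a·229^m`, reduced exponents `a < n`, `m < n` (RULING H1). GENERATED by p-lean g2 gen/make_rows.py
(after plean/make_cell_bridges.py).
-/

namespace Summit.Ventures.AbcSig

/-- Cell `C2aL229A45` (M6 orbits discharged in the kernel): `Rows.C2aCellRed 229 (fun a => a = 4 ∨ a = 5) ∅` under the rows' hypotheses. -/
theorem xcell_C2aL229A45 (M : NewformModel) (hP : M.BS04Package)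
    (hE : M.EisPackage)
    (hD458 : M.DataComplete 458 level458Orbits)
    (hD1832 : M.DataComplete 1832 level1832Orbits)
    (hR_orbit_458_5 : M.Refines 458 orbit_458_5 m6X_458_5) :
    Rows.C2aCellRed 229 (fun a => a = 4 ∨ a = 5) ∅ :=
  C2aCellRed_of_rows 229 (by norm_num) (by norm_num) _ _
    (fun n hn h11 hnℓ _ a m ha han hm hmn x y z h1 h2 =>
      xrow_C2aL229A45 M hP hE hD458 hD1832 hR_orbit_458_5 n hn h11 hnℓ a m ha hm han hmn x y z h1 h2)
    (fun n hn h11 hnℓ _ a m ha han hm hmn x y z h1 h2 =>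
      xrow_C2aL229A45AB M hP hE hD458 hD1832 hR_orbit_458_5 n hn h11 hnℓ a m ha hm han hmn x y z h1 h2)

end Summit.Ventures.AbcSig
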